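import Mathlib
import Literature.Barriers.ValiantsHypothesis.AlgebraicNaturalProofs
import HarnessLib

/-!
# Crux `BarrierLever.SuccinctHittingSetsForVP` (stmt-ValiantsHypothesis-14610), line `registered` —
STUB `stub_prodSparsity`: OLIVEIRA'S PRODUCT-SPARSITY LEMMA

**What is proved (unconditional; it does NOT close the item, it discharges the registered stub
`stub_prodSparsity` of the sparse half of the skeleton).** For a finite set `S` of variables, a
vector `a` with `a i ≠ 0` for all `i ∈ S`, and a NONZERO polynomial `H` over `ℂ` (in any set of
variables), the product `(∏_{i ∈ S} (X_i - a_i)) · H` has at least `2 ^ |S|` monomials: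

* `ProdSparsity.card_add_card_le_card_support` : the univariate core — if `j₀` (resp. `j₁`) bounds
  the `X_i`-degrees of the monomials of `Q` from below (resp. above) and `Q₀`, `Q₁` are the parts of
  `Q` in `X_i`-degree `j₀`, `j₁`, then `(X_i - c) · Q` (`c ≠ 0`) has at least
  `|supp Q₀| + |supp Q₁|` monomials (the bottom slice survives times `-c`, the top slice survives
  shifted by `X_i`, disjointly);
* `ProdSparsity.step` : hence one more linear factor `X_i - c` in a variable not occurring in `R`
  doubles any uniform lower bound on the sparsity of the multiples `R · G`, `G ≠ 0`;
* `stub_prodSparsity` (registered stub) : induction on `S`.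

This is [ForbesShpilkaVolk2018, Lemma 33] (= Forbes–Saptharishi–Tse–Wigderson 2016, Prop. 6.14, the
special case needed there); it feeds FSV18 Lemma 32 (sparsity of a full-support shift) and thereby
the sparse hitting theorem (FSV18 Thm. 9 / Cor. 34) in the composition of the skeleton
`Cruxes/SuccinctHittingSetsForVP/Lines/birth.lean`.
Axioms: `propext`, `Classical.choice`, `Quot.sound`.
-/

-- layout Summits/ValiantsHypothesis/ValiantsHypothesis forces the duplicated namespace component
set_option linter.dupNamespace false

namespace Summit.ValiantsHypothesis.ValiantsHypothesis.Theorems.BarrierLever.SuccinctHittingSetsForVP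

open Literature.Barriers.ValiantsHypothesis Literature.Computability.AlgebraicComplexity MvPolynomial

namespace ProdSparsity

variable {σ : Type*}

/-- Coefficients of the `X_i`-degree-`j` slice of `H`, realised as the weighted homogeneous
component for the weight `Pi.single i 1`. [folklore] -/
theorem coeff_slice [DecidableEq σ] (i : σ) (j : ℕ) (H : MvPolynomial σ ℂ) (m : σ →₀ ℕ) :
    coeff m (weightedHomogeneousComponent (Pi.single i 1) j H) =
      if m i = j then coeff m H else 0 := by
  rw [coeff_weightedHomogeneousComponent, Finsupp.weight_single_one_apply]

/-- Support of the `X_i`-degree-`j` slice of `H`. [folklore] -/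
theorem mem_support_slice [DecidableEq σ] {i : σ} {j : ℕ} {H : MvPolynomial σ ℂ} {m : σ →₀ ℕ} :
    m ∈ (weightedHomogeneousComponent (Pi.single i 1) j H).support ↔ m i = j ∧ m ∈ H.support := by
  rw [mem_support_iff, mem_support_iff, coeff_slice]
  split_ifs with h
  · exact (and_iff_right h).symm
  · simp [h]

/-- The slice of `H` through one of its monomials is nonzero. [folklore] -/
theorem slice_ne_zero [DecidableEq σ] (i : σ) {H : MvPolynomial σ ℂ} {m : σ →₀ ℕ}
    (hm : m ∈ H.support) : weightedHomogeneousComponent (Pi.single i 1) (m i) H ≠ 0 := by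
  intro h0
  have h := coeff_slice i (m i) H m
  rw [h0, coeff_zero, if_pos rfl] at h
  exact mem_support_iff.mp hm h.symm

/-- If `R` does not involve `X_i`, the `X_i`-degree of a monomial of `R * G` is the `X_i`-degree of
a monomial of `G`. [folklore] -/
theorem apply_of_mem_support_mul {i : σ} {R G : MvPolynomial σ ℂ} (hR : ∀ u ∈ R.support, u i = 0)
    {p : ℕ → Prop} (hG : ∀ v ∈ G.support, p (v i)) {m : σ →₀ ℕ} (hm : m ∈ (R * G).support) :
    p (m i) := by
  classical
  obtain ⟨u, hu, v, hv, rfl⟩ := Finset.mem_add.mp (support_mul R G hm)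
  rw [Finsupp.add_apply, hR u hu, zero_add]
  exact hG v hv

/-- If `R` does not involve `X_i`, the coefficient of `m` in `R * H` only sees the slice of `H` of
`X_i`-degree `m i`. [folklore] -/
theorem coeff_mul_eq_coeff_mul_slice [DecidableEq σ] {i : σ} {R : MvPolynomial σ ℂ}
    (hR : ∀ u ∈ R.support, u i = 0) (H : MvPolynomial σ ℂ) (m : σ →₀ ℕ) :
    coeff m (R * H) = coeff m (R * weightedHomogeneousComponent (Pi.single i 1) (m i) H) := by
  have hrest : coeff m (R * (H - weightedHomogeneousComponent (Pi.single i 1) (m i) H)) = 0 := by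
    by_contra h
    have key : ∀ v ∈ (H - weightedHomogeneousComponent (Pi.single i 1) (m i) H).support,
        ¬ v i = m i := by
      intro v hv hvi
      rw [mem_support_iff, coeff_sub, coeff_slice, if_pos hvi, sub_self] at hv
      exact hv rfl
    exact absurd rfl (apply_of_mem_support_mul hR (p := fun k => ¬ k = m i) key
      (mem_support_iff.mpr h))
  calc coeff m (R * H)
      = coeff m (R * weightedHomogeneousComponent (Pi.single i 1) (m i) H +
          R * (H - weightedHomogeneousComponent (Pi.single i 1) (m i) H)) := by
        rw [← mul_add, add_sub_cancel]
    _ = coeff m (R * weightedHomogeneousComponent (Pi.single i 1) (m i) H) := by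
        rw [coeff_add, hrest, add_zero]

/-- **Univariate core.** If the `X_i`-degrees of the monomials of `Q` lie in `[j₀, j₁]`, and `Q₀`,
`Q₁` are polynomials living in `X_i`-degree `j₀`, `j₁` whose coefficients agree with those of `Q`
on their supports, then for `c ≠ 0` the product `(X_i - c) · Q` has at least
`|supp Q₀| + |supp Q₁|` monomials: `supp Q₀` survives (times `-c`) and `supp Q₁` survives shifted
by `X_i`, disjointly. [cite: ForbesShpilkaVolk2018, Lemma 33] -/
theorem card_add_card_le_card_support (i : σ) {c : ℂ} (hc : c ≠ 0) {Q Q₀ Q₁ : MvPolynomial σ ℂ}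
    {j₀ j₁ : ℕ} (hj : j₀ ≤ j₁) (hlow : ∀ m ∈ Q.support, j₀ ≤ m i)
    (hhigh : ∀ m ∈ Q.support, m i ≤ j₁) (hdeg₀ : ∀ m ∈ Q₀.support, m i = j₀)
    (hdeg₁ : ∀ m ∈ Q₁.support, m i = j₁) (hcoeff₀ : ∀ m ∈ Q₀.support, coeff m Q = coeff m Q₀)
    (hcoeff₁ : ∀ m ∈ Q₁.support, coeff m Q = coeff m Q₁) :
    Q₀.support.card + Q₁.support.card ≤ ((X i - C c) * Q).support.card := by
  classical
  have hP : ∀ m : σ →₀ ℕ, coeff m ((X i - C c) * Q) =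
      (if i ∈ m.support then coeff (m - Finsupp.single i 1) Q else 0) - c * coeff m Q :=
    fun m => by rw [sub_mul, coeff_sub, coeff_X_mul', coeff_C_mul]
  have hA : Q₀.support ⊆ ((X i - C c) * Q).support := by
    intro m hm
    have hmi := hdeg₀ m hm
    rw [mem_support_iff, hP]
    have h1 : (if i ∈ m.support then coeff (m - Finsupp.single i 1) Q else 0) = 0 := by
      split_ifs with him
      · by_contra hne
        have h2 := hlow _ (mem_support_iff.mpr hne)
        rw [Finsupp.tsub_apply, Finsupp.single_eq_same, hmi] at h2
        rw [Finsupp.mem_support_iff, hmi] at him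
        omega
      · rfl
    rw [h1, zero_sub, neg_ne_zero, hcoeff₀ m hm]
    exact mul_ne_zero hc (mem_support_iff.mp hm)
  have hB : Q₁.support.image (· + Finsupp.single i 1) ⊆ ((X i - C c) * Q).support := by
    intro m hm
    obtain ⟨m', hm', rfl⟩ := Finset.mem_image.mp hm
    have hmi := hdeg₁ m' hm'
    rw [mem_support_iff, hP]
    have him : i ∈ (m' + Finsupp.single i 1).support := by
      rw [Finsupp.mem_support_iff, Finsupp.add_apply, Finsupp.single_eq_same]; omega
    have h2 : coeff (m' + Finsupp.single i 1) Q = 0 := by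
      by_contra hne
      have h3 := hhigh _ (mem_support_iff.mpr hne)
      rw [Finsupp.add_apply, Finsupp.single_eq_same, hmi] at h3
      omega
    rw [if_pos him, add_tsub_cancel_right, h2, mul_zero, sub_zero, hcoeff₁ m' hm']
    exact mem_support_iff.mp hm'
  have hAB : Disjoint Q₀.support (Q₁.support.image (· + Finsupp.single i 1)) := by
    rw [Finset.disjoint_left]
    intro m hmA hmB
    obtain ⟨m', hm', rfl⟩ := Finset.mem_image.mp hmB
    have h1 := hdeg₀ _ hmA
    rw [Finsupp.add_apply, Finsupp.single_eq_same, hdeg₁ m' hm'] at h1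
    omega
  rw [← Finset.card_image_of_injective Q₁.support (add_left_injective (Finsupp.single i 1)),
    ← Finset.card_union_of_disjoint hAB]
  exact Finset.card_le_card (Finset.union_subset hA hB)

/-- **Inductive step.** If `R` does not involve `X_i` and every multiple `R · G` (`G ≠ 0`) has at
least `N` monomials, then for `c ≠ 0` and `H ≠ 0` the product `(X_i - c) · (R · H)` has at least
`N + N` monomials: apply the univariate core to the bottom and top `X_i`-slices `H₀`, `H₁` of `H`
(`R · H₀`, `R · H₁` are the corresponding slices of `R · H`). [cite: ForbesShpilkaVolk2018, Lemma 33] -/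
theorem step (i : σ) {c : ℂ} (hc : c ≠ 0) {R : MvPolynomial σ ℂ} (hR : ∀ u ∈ R.support, u i = 0)
    {N : ℕ} (hN : ∀ G : MvPolynomial σ ℂ, G ≠ 0 → N ≤ (R * G).support.card)
    {H : MvPolynomial σ ℂ} (hH : H ≠ 0) : N + N ≤ ((X i - C c) * (R * H)).support.card := by
  classical
  obtain ⟨m₀, hm₀, hmin⟩ : ∃ m₀ ∈ H.support, ∀ m ∈ H.support, m₀ i ≤ m i :=
    H.support.exists_min_image (fun m => m i) (support_nonempty.mpr hH)
  obtain ⟨m₁, hm₁, hmax⟩ : ∃ m₁ ∈ H.support, ∀ m ∈ H.support, m i ≤ m₁ i :=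
    H.support.exists_max_image (fun m => m i) (support_nonempty.mpr hH)
  have hdeg : ∀ j : ℕ, ∀ m ∈ (R * weightedHomogeneousComponent (Pi.single i 1) j H).support,
      m i = j :=
    fun j m hm => apply_of_mem_support_mul hR (p := fun k => k = j)
      (fun v hv => (mem_support_slice.mp hv).1) hm
  have hcoeff : ∀ j : ℕ, ∀ m ∈ (R * weightedHomogeneousComponent (Pi.single i 1) j H).support,
      coeff m (R * H) = coeff m (R * weightedHomogeneousComponent (Pi.single i 1) j H) :=
    fun j m hm => by rw [coeff_mul_eq_coeff_mul_slice hR H m, hdeg j m hm]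
  refine le_trans (add_le_add (hN _ (slice_ne_zero i hm₀)) (hN _ (slice_ne_zero i hm₁))) ?_
  exact card_add_card_le_card_support i hc (hmin m₁ hm₁)
    (fun m hm => apply_of_mem_support_mul hR (p := fun k => m₀ i ≤ k) hmin hm)
    (fun m hm => apply_of_mem_support_mul hR (p := fun k => k ≤ m₁ i) hmax hm)
    (hdeg _) (hdeg _) (hcoeff _) (hcoeff _)

/-- The product `∏_{j ∈ S} (X_j - a_j)` does not involve `X_i` for `i ∉ S`. [folklore] -/
theorem prod_support_apply (S : Finset σ) (a : σ → ℂ) {i : σ} (hi : i ∉ S) :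
    ∀ u ∈ (∏ j ∈ S, (X j - C (a j)) : MvPolynomial σ ℂ).support, u i = 0 := by
  classical
  intro u hu
  by_contra h
  have hmem : i ∈ (∏ j ∈ S, (X j - C (a j)) : MvPolynomial σ ℂ).vars :=
    (mem_vars_iff_mem_support i).mpr ⟨u, hu, Finsupp.mem_support_iff.mpr h⟩
  obtain ⟨j, hj, hij⟩ :=
    Finset.mem_biUnion.mp (vars_prod (fun j => (X j - C (a j) : MvPolynomial σ ℂ)) hmem)
  rcases Finset.mem_union.mp (vars_sub_subset _ hij) with h' | h'
  · rw [vars_X, Finset.mem_singleton] at h'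
    subst h'
    exact hi hj
  · simp [vars_C] at h'

end ProdSparsity

/-- **Registered stub `stub_prodSparsity`** (crux stmt-ValiantsHypothesis-14610, line `registered`):
Oliveira's product-sparsity lemma, the special case needed — multiplying a nonzero polynomial `H`
by `∏_{i ∈ S} (X_i - a_i)` with all `a_i ≠ 0` yields at least `2 ^ |S|` monomials. Induction on
`S` via `ProdSparsity.step`. [cite: ForbesShpilkaVolk2018, Lemma 33] -/
theorem stub_prodSparsity :
    ∀ (ι : Type) (S : Finset ι) (a : ι → ℂ), (∀ i ∈ S, a i ≠ 0) →
      ∀ H : MvPolynomial ι ℂ, H ≠ 0 →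
        2 ^ S.card ≤ ((∏ i ∈ S, (X i - C (a i))) * H).support.card := by
  intro ι S a
  classical
  induction S using Finset.induction_on with
  | empty =>
    intro _ H hH
    rw [Finset.prod_empty, one_mul, Finset.card_empty, pow_zero]
    exact (support_nonempty.mpr hH).card_pos
  | insert i S hi ih =>
    intro ha H hH
    rw [Finset.prod_insert hi, mul_assoc, Finset.card_insert_of_notMem hi, pow_succ, mul_two]
    exact ProdSparsity.step i (ha i (Finset.mem_insert_self i S))
      (ProdSparsity.prod_support_apply S a hi)
      (fun G hG => ih (fun k hk => ha k (Finset.mem_insert_of_mem hk)) G hG) hH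

end Summit.ValiantsHypothesis.ValiantsHypothesis.Theorems.BarrierLever.SuccinctHittingSetsForVP
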